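import Summits.ValiantsHypothesis.ValiantsHypothesis.Theorems.SuccinctPartitionMinorsTotalPositivity

/-!
# One `VNP`-succinct point for every partition — the quadratic exponent `2^{bin(S)²}`

(`decomp-valiant`, lens 2 «natural-proofs / succinctness axis», offer O-L2-13; a helper for route
`BarrierLever`'s open item `PartitionMinorsHitByVP`, which it does NOT close.)

`SuccinctPartitionMinorsTotalPositivity` hit every square minor of the partition matrix of ONE
FIXED balanced partition `x | y` by a definable point with coefficients `2^{bin(U) · bin(W)}`.
Here a single point does it for ALL partitions at once.  The `n`-variate multilinear polynomial

  `f_n = Σ_{S ⊆ [n]} 2^{bin(S)²} x^S`,  `bin(S) = Σ_{a ∈ S} 2^a`,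

is a Valiant Boolean sum of a circuit of size `O(n²)` (`f_n ∈ SmallDefinable F n 3` for `n ≥ 6` —
KRST Def. 3 in the constants-allowed model: the doubly-exponential scalars `2^{2^{a+c}}` of the
weight are single constant gates of cost `0`, `complexity_C`), and for EVERY two injective
families of sets `A_1, …, A_r`, `B_1, …, B_r ⊆ [n]`
with `A_i ∩ B_j = ∅` for all `i, j` — the rows and columns of a square minor of the partition
(partial-derivative) matrix of ANY set partition `[n] = Y ⊔ Z` with `A_i ⊆ Y`, `B_j ⊆ Z`,
balanced or not — the minor `det [coeff_{x^{A_i ∪ B_j}} f_n]_{i,j}` is non-zero: for disjoint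
`A, B` one has `bin(A ∪ B) = bin A + bin B`, hence

  `2^{bin(A_i ∪ B_j)²} = 2^{bin(A_i)²} · 2^{bin(B_j)²} · 2^{bin(A_i) · 2 bin(B_j)}`,

so the minor is `∏_i 2^{bin(A_i)²} · ∏_j 2^{bin(B_j)²}` times the injective generalized
Vandermonde determinant `det [2^{p_i q_j}] ≠ 0` of `SuccinctPartitionMinorsTotalPositivity`
(`det_two_pow_mul_ne_zero`, Gantmacher XIII §8).

In the language of algebraically natural proofs [ForbesShpilkaVolk2018, Def. 1 and Def. 3]: for
every `n ≥ 6` and every monomial set `M`, the multiplicative monoid generated by ALL square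
partition minors of ALL partitions — the distinguishers of the partial-derivative-matrix rank
method with a VARYING partition [Raz2009; Raz2006; RazYehudayoff2008], which read a coefficient
many times — is hit by `SmallDefinable F n 3`, by one point for all of them, and that point lies
in the multilinear slice (the relative form `IsSuccinctHittingSetRel … (multilinearSlice F n)`).

Main results (any field of characteristic `0`):
* `coeff_point` — `coeff_{x^S} f_n = 2^{bin(S)²}`;
* `det_partitionMinor_point_ne_zero` — every partition minor of `f_n` is non-zero;
* `exists_smallDefinable_allPartitions_totallyNonsingular` — headline, `b = 3`, `n₀ = 6`;
* `point_partitionMinorMonoid_ne_zero`, `partitionMinorMonoid_isSuccinctHittingSet` — the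
  monoid / `IsSuccinctHittingSet` / multilinear-slice forms.
-/

-- layout Summits/ValiantsHypothesis/ValiantsHypothesis forces the duplicated namespace component
set_option linter.dupNamespace false

namespace Summit.ValiantsHypothesis.ValiantsHypothesis.Theorems.SuccinctPartitionMinorsAllPartitions

open MvPolynomial Literature.Barriers.ValiantsHypothesis
open Literature.Computability.AlgebraicComplexity
open Literature.Computability.AlgebraicComplexity.CircuitArith (toK)
open Literature.Computability.AlgebraicComplexity.BoolGadgets
open Summit.ValiantsHypothesis.ValiantsHypothesis.Theorems.SuccinctPartitionMinors

/-! ### §1 Bits of a disjoint union -/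

/-- `bin(U ∪ W) = bin U + bin W` for disjoint `U, W`, where `bin U = Nat.ofBits [· ∈ U]`.
[folklore] -/
theorem ofBits_indicator_union {n : ℕ} {U W : Finset (Fin n)} (h : Disjoint U W) :
    Nat.ofBits (fun a : Fin n => decide (a ∈ U ∪ W)) =
      Nat.ofBits (fun a : Fin n => decide (a ∈ U)) +
        Nat.ofBits (fun a : Fin n => decide (a ∈ W)) := by
  rw [ofBits_eq_sum, ofBits_eq_sum, ofBits_eq_sum, ← Finset.sum_add_distrib]
  refine Finset.sum_congr rfl fun a _ => ?_
  by_cases hU : a ∈ U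
  · have hW : a ∉ W := Finset.disjoint_left.mp h hU
    simp [hU, hW]
  · by_cases hW : a ∈ W <;> simp [hU, hW]

section Point

variable {F : Type*} [Field F]

/-! ### §2 The diagonal weight `W_n(x, x)` and the point `f_n = Σ_e selProd(e; x) · W_n(e, e)` -/

/-- **The diagonal weight at a bit vector is `2^{bin(e)²}`**: both halves of the total-positivity
weight `∏_{a,c} (1 + (2^{2^{a+c}} − 1) x_a y_c)` renamed to the same variables evaluate at `[e]`
to `2^{bin e · bin e}`. [cite: Gantmacher1984, Vol. 2, Ch. XIII §8, Example 1] -/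
theorem eval_weight_diag (n : ℕ) (e : Fin n → Bool) :
    eval (fun a => toK F (e a))
      (rename (Fin.append (fun a : Fin n => a) (fun c : Fin n => c))
        (∏ a : Fin n, ∏ c : Fin n, (1 + C ((2 : F) ^ (2 ^ ((a : ℕ) + (c : ℕ))) - 1) *
          (X (Fin.castAdd n a) * X (Fin.natAdd n c))) : MvPolynomial (Fin (n + n)) F)) =
      (2 : F) ^ (Nat.ofBits e * Nat.ofBits e) := by
  rw [eval_rename]
  have hcomp : ((fun a : Fin n => toK F (e a)) ∘
      Fin.append (fun a : Fin n => a) (fun c : Fin n => c)) =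
        fun v => toK F (Fin.append e e v) := by
    refine funext (Fin.addCases (fun a => ?_) fun c => ?_)
    · simp only [Function.comp_apply, Fin.append_left]
    · simp only [Function.comp_apply, Fin.append_right]
  rw [hcomp]
  exact eval_weight_append n e e

/-- **The coefficients of the point**: `coeff_{x^S} f_n = 2^{bin(S) · bin(S)}` for every
`S ⊆ [n]`. [cite: Valiant1979] -/
theorem coeff_point (n : ℕ) (S : Finset (Fin n)) :
    coeff (∑ a ∈ S, Finsupp.single a 1)
      (boolSum (selProd (fun t : Fin n => (X (Sum.inr t) : MvPolynomial (Fin n ⊕ Fin n) F))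
          (fun t => X (Sum.inl t)) *
        rename Sum.inr (rename (Fin.append (fun a : Fin n => a) (fun c : Fin n => c))
          (∏ a : Fin n, ∏ c : Fin n, (1 + C ((2 : F) ^ (2 ^ ((a : ℕ) + (c : ℕ))) - 1) *
            (X (Fin.castAdd n a) * X (Fin.natAdd n c))) : MvPolynomial (Fin (n + n)) F)))) =
      (2 : F) ^ (Nat.ofBits (fun a : Fin n => decide (a ∈ S)) *
        Nat.ofBits (fun a : Fin n => decide (a ∈ S))) := by
  rw [← sum_single_indicator S (fun a : Fin n => a), coeff_boolSum_selProd_mul_rename]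
  exact eval_weight_diag n fun a => decide (a ∈ S)

/-- **The point is `VNP`-succinct**: `f_n ∈ SmallDefinable F n 3` for `n ≥ 6` (`u = n` Boolean
variables, `L(g) ≤ 5n + (4n² + n) + 1 ≤ n³`, `deg g ≤ 2n + 2n² ≤ n³`, `deg f_n ≤ n`).
[cite: KumarRamyaSaptharishiTengse2022, Def. 3] -/
theorem point_mem_smallDefinable {n : ℕ} (hn : 6 ≤ n) :
    boolSum (selProd (fun t : Fin n => (X (Sum.inr t) : MvPolynomial (Fin n ⊕ Fin n) F))
          (fun t => X (Sum.inl t)) *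
        rename Sum.inr (rename (Fin.append (fun a : Fin n => a) (fun c : Fin n => c))
          (∏ a : Fin n, ∏ c : Fin n, (1 + C ((2 : F) ^ (2 ^ ((a : ℕ) + (c : ℕ))) - 1) *
            (X (Fin.castAdd n a) * X (Fin.natAdd n c))) : MvPolynomial (Fin (n + n)) F))) ∈
      SmallDefinable F n 3 := by
  have hN : n ≤ n ^ 3 := Nat.le_self_pow (by norm_num) _
  have hcube : n ^ 3 = n * (n * n) := by ring
  have hsq : n ^ 2 = n * n := by ring
  have h4 : 6 * (n * n) ≤ n * (n * n) := Nat.mul_le_mul_right _ hn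
  have h5 : 6 * n ≤ n * n := Nat.mul_le_mul_right _ hn
  refine ⟨totalDegree_boolSum_selProd_mul_rename_le _, n, hN, _,
    (complexity_selProd_mul_rename_le _).trans ?_,
    (totalDegree_selProd_mul_rename_le _).trans ?_, rfl⟩
  · have h1 := complexity_rename_le_holds' (k := F)
      (Fin.append (fun a : Fin n => a) (fun c : Fin n => c))
      (∏ a : Fin n, ∏ c : Fin n, (1 + C ((2 : F) ^ (2 ^ ((a : ℕ) + (c : ℕ))) - 1) *
        (X (Fin.castAdd n a) * X (Fin.natAdd n c))) : MvPolynomial (Fin (n + n)) F)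
    have h2 := complexity_weight_le (F := F) n
    rw [hsq] at h2
    rw [hcube]
    omega
  · have h1 := totalDegree_rename_le (Fin.append (fun a : Fin n => a) (fun c : Fin n => c))
      (∏ a : Fin n, ∏ c : Fin n, (1 + C ((2 : F) ^ (2 ^ ((a : ℕ) + (c : ℕ))) - 1) *
        (X (Fin.castAdd n a) * X (Fin.natAdd n c))) : MvPolynomial (Fin (n + n)) F)
    have h2 := totalDegree_weight_le (F := F) n
    rw [hsq] at h2
    rw [hcube]
    omega

/-- **The point is multilinear** (`f_n ∈ multilinearSlice F n`): its support consists of the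
exponent vectors `m(e) = Σ_t [e t]·1_t`. [cite: ForbesShpilkaVolk2018, §1.2 and Thm. 9] -/
theorem point_mem_multilinearSlice (n : ℕ) :
    boolSum (selProd (fun t : Fin n => (X (Sum.inr t) : MvPolynomial (Fin n ⊕ Fin n) F))
          (fun t => X (Sum.inl t)) *
        rename Sum.inr (rename (Fin.append (fun a : Fin n => a) (fun c : Fin n => c))
          (∏ a : Fin n, ∏ c : Fin n, (1 + C ((2 : F) ^ (2 ^ ((a : ℕ) + (c : ℕ))) - 1) *
            (X (Fin.castAdd n a) * X (Fin.natAdd n c))) : MvPolynomial (Fin (n + n)) F))) ∈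
      multilinearSlice F n := by
  intro m hm i
  rw [boolSum_selProd_mul_rename] at hm
  obtain ⟨e, -, he⟩ := Finset.mem_biUnion.mp (support_sum hm)
  rw [Finset.mem_singleton.mp (support_monomial_subset he)]
  have hle : ∀ b : Bool, b.toNat ≤ 1 := fun b => by cases b <;> simp
  simpa [Finsupp.finsetSum_apply, Finsupp.single_apply] using hle (e i)

/-- **Every partition minor of the point is non-zero.** For injective `A, B : Fin r → 𝒫([n])`
with `A i ∩ B j = ∅` for all `i, j`, `det [coeff_{x^{A_i ∪ B_j}} f_n] =
∏_i 2^{bin(A_i)²} · ∏_j 2^{bin(B_j)²} · det [2^{bin(A_i) · 2 bin(B_j)}] ≠ 0` (injective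
generalized Vandermonde). [cite: Gantmacher1984, Vol. 2, Ch. XIII §8, Example 1] -/
theorem det_partitionMinor_point_ne_zero [CharZero F] (n : ℕ) {r : ℕ}
    {A B : Fin r → Finset (Fin n)} (hA : Function.Injective A) (hB : Function.Injective B)
    (hAB : ∀ i j, Disjoint (A i) (B j)) :
    (Matrix.of fun i j : Fin r => coeff (∑ a ∈ A i, Finsupp.single a 1 +
        ∑ c ∈ B j, Finsupp.single c 1)
      (boolSum (selProd (fun t : Fin n => (X (Sum.inr t) : MvPolynomial (Fin n ⊕ Fin n) F))
          (fun t => X (Sum.inl t)) *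
        rename Sum.inr (rename (Fin.append (fun a : Fin n => a) (fun c : Fin n => c))
          (∏ a : Fin n, ∏ c : Fin n, (1 + C ((2 : F) ^ (2 ^ ((a : ℕ) + (c : ℕ))) - 1) *
            (X (Fin.castAdd n a) * X (Fin.natAdd n c))) :
              MvPolynomial (Fin (n + n)) F))))).det ≠ 0 := by
  have key : (Matrix.of fun i j : Fin r => coeff (∑ a ∈ A i, Finsupp.single a 1 +
        ∑ c ∈ B j, Finsupp.single c 1)
      (boolSum (selProd (fun t : Fin n => (X (Sum.inr t) : MvPolynomial (Fin n ⊕ Fin n) F))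
          (fun t => X (Sum.inl t)) *
        rename Sum.inr (rename (Fin.append (fun a : Fin n => a) (fun c : Fin n => c))
          (∏ a : Fin n, ∏ c : Fin n, (1 + C ((2 : F) ^ (2 ^ ((a : ℕ) + (c : ℕ))) - 1) *
            (X (Fin.castAdd n a) * X (Fin.natAdd n c))) :
              MvPolynomial (Fin (n + n)) F))))) =
      Matrix.of (fun i j : Fin r =>
        (fun i => (2 : F) ^ (Nat.ofBits (fun a : Fin n => decide (a ∈ A i)) *
          Nat.ofBits (fun a : Fin n => decide (a ∈ A i)))) i *
        (Matrix.of fun i j : Fin r =>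
          (fun j => (2 : F) ^ (Nat.ofBits (fun a : Fin n => decide (a ∈ B j)) *
            Nat.ofBits (fun a : Fin n => decide (a ∈ B j)))) j *
          (Matrix.of fun i j : Fin r =>
            (2 : F) ^ (Nat.ofBits (fun a : Fin n => decide (a ∈ A i)) *
              (2 * Nat.ofBits (fun a : Fin n => decide (a ∈ B j))))) i j) i j) := by
    ext i j
    simp only [Matrix.of_apply]
    rw [← Finset.sum_union (hAB i j), coeff_point, ofBits_indicator_union (hAB i j), ← pow_add,
      ← pow_add]
    congr 1
    ring
  rw [key, Matrix.det_mul_column, Matrix.det_mul_row]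
  have h2 : (2 : F) ≠ 0 := two_ne_zero
  have hp : Function.Injective fun i : Fin r =>
      Nat.ofBits (fun a : Fin n => decide (a ∈ A i)) :=
    ofBits_indicator_injective.comp hA
  have hq : Function.Injective fun j : Fin r =>
      2 * Nat.ofBits (fun a : Fin n => decide (a ∈ B j)) :=
    fun j₁ j₂ h => (ofBits_indicator_injective.comp hB)
      (Nat.eq_of_mul_eq_mul_left (by norm_num) h)
  exact mul_ne_zero (Finset.prod_ne_zero_iff.mpr fun i _ => pow_ne_zero _ h2)
    (mul_ne_zero (Finset.prod_ne_zero_iff.mpr fun j _ => pow_ne_zero _ h2)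
      (det_two_pow_mul_ne_zero hp hq))

/-! ### §3 The monoid of partition minors, as distinguishers in coefficient variables -/

/-- **One point for the whole monoid of partition minors.** For every monomial set `M`, every
finite product `D` of determinants `det [X_{μ i j}]` of coefficient variables indexed by the
partition monomials `x^{A_i ∪ B_j}` (`A, B` injective, `A_i ∩ B_j = ∅`) is non-zero at the
coefficient vector `coeff_M (f_n)` (FSV Def. 1/3 with the rank method's minors for every
partition as `𝒟`). [cite: ForbesShpilkaVolk2018, Def. 3 and §8] [cite: Raz2006, §1] -/
theorem point_partitionMinorMonoid_ne_zero [CharZero F] {n : ℕ} (M : Set (Fin n →₀ ℕ))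
    {D : MvPolynomial M F}
    (hD : D ∈ Submonoid.closure {P : MvPolynomial M F | ∃ (r : ℕ) (μ : Fin r → Fin r → M)
      (A B : Fin r → Finset (Fin n)), Function.Injective A ∧ Function.Injective B ∧
        (∀ i j, Disjoint (A i) (B j)) ∧
        (∀ i j, ((μ i j : M) : Fin n →₀ ℕ) =
          ∑ a ∈ A i, Finsupp.single a 1 + ∑ c ∈ B j, Finsupp.single c 1) ∧
        P = (Matrix.of fun i j : Fin r => (X (μ i j) : MvPolynomial M F)).det}) :
    eval (coeffVector M
      (boolSum (selProd (fun t : Fin n => (X (Sum.inr t) : MvPolynomial (Fin n ⊕ Fin n) F))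
          (fun t => X (Sum.inl t)) *
        rename Sum.inr (rename (Fin.append (fun a : Fin n => a) (fun c : Fin n => c))
          (∏ a : Fin n, ∏ c : Fin n, (1 + C ((2 : F) ^ (2 ^ ((a : ℕ) + (c : ℕ))) - 1) *
            (X (Fin.castAdd n a) * X (Fin.natAdd n c))) :
              MvPolynomial (Fin (n + n)) F))))) D ≠ 0 := by
  induction hD using Submonoid.closure_induction with
  | mem P hP =>
    obtain ⟨r, μ, A, B, hA, hB, hAB, hμ, rfl⟩ := hP
    rw [RingHom.map_det]
    have hmat : (eval (coeffVector M
        (boolSum (selProd (fun t : Fin n => (X (Sum.inr t) : MvPolynomial (Fin n ⊕ Fin n) F))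
            (fun t => X (Sum.inl t)) *
          rename Sum.inr (rename (Fin.append (fun a : Fin n => a) (fun c : Fin n => c))
            (∏ a : Fin n, ∏ c : Fin n, (1 + C ((2 : F) ^ (2 ^ ((a : ℕ) + (c : ℕ))) - 1) *
              (X (Fin.castAdd n a) * X (Fin.natAdd n c))) :
                MvPolynomial (Fin (n + n)) F)))))).mapMatrix
          (Matrix.of fun i j : Fin r => (X (μ i j) : MvPolynomial M F)) =
        Matrix.of fun i j : Fin r => coeff (∑ a ∈ A i, Finsupp.single a 1 +
            ∑ c ∈ B j, Finsupp.single c 1)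
          (boolSum (selProd (fun t : Fin n => (X (Sum.inr t) :
              MvPolynomial (Fin n ⊕ Fin n) F)) (fun t => X (Sum.inl t)) *
            rename Sum.inr (rename (Fin.append (fun a : Fin n => a) (fun c : Fin n => c))
              (∏ a : Fin n, ∏ c : Fin n, (1 + C ((2 : F) ^ (2 ^ ((a : ℕ) + (c : ℕ))) - 1) *
                (X (Fin.castAdd n a) * X (Fin.natAdd n c))) :
                  MvPolynomial (Fin (n + n)) F)))) := by
      ext i j
      simp only [RingHom.mapMatrix_apply, Matrix.map_apply, Matrix.of_apply, eval_X,
        coeffVector_apply, hμ]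
    rw [hmat]
    exact det_partitionMinor_point_ne_zero n hA hB hAB
  | one => rw [map_one]; exact one_ne_zero
  | mul P Q _ _ ihP ihQ => rw [map_mul]; exact mul_ne_zero ihP ihQ

end Point

/-! ### §4 The theorems -/

/-- **ONE `VNP`-succinct point per `n` with EVERY partition minor of EVERY partition
non-singular.** For every field `F` of characteristic `0`: with `b = 3`, `n₀ = 6`, for every
`n ≥ n₀` some `f ∈ SmallDefinable F n b` (KRST Def. 3) satisfies
`det [coeff_{x^{A_i ∪ B_j}} f]_{i,j < r} ≠ 0` for every `r` and all injective
`A, B : Fin r → 𝒫(Fin n)` with `A i ∩ B j = ∅` for all `i, j` — i.e. every square minor of the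
partition matrix of every set partition (balanced or not) at once. The fixed balanced
partition `x | y` of `exists_smallDefinable_totallyNonsingular` is the special case
`A i = castAdd '' (u i)`, `B j = natAdd '' (w j)`; the varying partitions are those of the
rank method of [Raz2009] / [Raz2006] / [RazYehudayoff2008]. [cite: ForbesShpilkaVolk2018, §8]
[cite: KumarRamyaSaptharishiTengse2022, Def. 3] [cite: Raz2006, §1]
[cite: Gantmacher1984, Vol. 2, Ch. XIII §8, Example 1] -/
theorem exists_smallDefinable_allPartitions_totallyNonsingular (F : Type*) [Field F]
    [CharZero F] :
    ∃ b n₀ : ℕ, ∀ n : ℕ, n₀ ≤ n → ∃ f ∈ SmallDefinable F n b,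
      ∀ (r : ℕ) (A B : Fin r → Finset (Fin n)), Function.Injective A →
        Function.Injective B → (∀ i j, Disjoint (A i) (B j)) →
          (Matrix.of fun i j : Fin r => MvPolynomial.coeff
            (∑ a ∈ A i, Finsupp.single a 1 + ∑ c ∈ B j, Finsupp.single c 1) f).det ≠ 0 :=
  ⟨3, 6, fun _ hn => ⟨_, point_mem_smallDefinable hn, fun _ _ _ hA hB hAB =>
    det_partitionMinor_point_ne_zero _ hA hB hAB⟩⟩

/-- **The same point is multilinear and hits the whole monoid of partition minors, for every
monomial set `M`.** With `b = 3`, `n₀ = 6`: for `n ≥ n₀` some `f ∈ SmallDefinable F n b ∩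
multilinearSlice F n` has `D(coeff_M f) ≠ 0` for every `D` in the multiplicative monoid generated
by the partition-minor determinants `det [X_{μ i j}]`, `μ i j = x^{A_i ∪ B_j}`.
[cite: ForbesShpilkaVolk2018, Def. 3 and §8] [cite: Raz2006, §1] -/
theorem exists_smallDefinable_multilinear_partitionMinorMonoid_ne_zero (F : Type*) [Field F]
    [CharZero F] :
    ∃ b n₀ : ℕ, ∀ n : ℕ, n₀ ≤ n → ∃ f ∈ SmallDefinable F n b, f ∈ multilinearSlice F n ∧
      ∀ (M : Set (Fin n →₀ ℕ)) (D : MvPolynomial M F),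
        D ∈ Submonoid.closure {P : MvPolynomial M F | ∃ (r : ℕ) (μ : Fin r → Fin r → M)
          (A B : Fin r → Finset (Fin n)), Function.Injective A ∧ Function.Injective B ∧
            (∀ i j, Disjoint (A i) (B j)) ∧
            (∀ i j, ((μ i j : M) : Fin n →₀ ℕ) =
              ∑ a ∈ A i, Finsupp.single a 1 + ∑ c ∈ B j, Finsupp.single c 1) ∧
            P = (Matrix.of fun i j : Fin r => (X (μ i j) : MvPolynomial M F)).det} →
        eval (coeffVector M f) D ≠ 0 :=
  ⟨3, 6, fun n hn => ⟨_, point_mem_smallDefinable hn, point_mem_multilinearSlice n,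
    fun M _ hD => point_partitionMinorMonoid_ne_zero M hD⟩⟩

/-- **Succinct hitting sets against the monoid of ALL partition minors (FSV Def. 3), absolute
and relative to the multilinear slice.** With `b = 3`, `n₀ = 6`: for every `n ≥ n₀` and every
monomial set `M`, `SmallDefinable F n b` is a succinct hitting set for the monoid generated by the
partition-minor determinants in the coefficient variables `(c_m)_{m ∈ M}`, and so is
`SmallDefinable F n b ∩ multilinearSlice F n` inside the multilinear slice — so no product of
partition minors (any partitions) is an algebraically natural proof against `VNP`-succinct
polynomials, even multilinear ones (FSV Thm. 4). [cite: ForbesShpilkaVolk2018, Def. 3 and Thm. 4]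
[cite: KumarRamyaSaptharishiTengse2022, Def. 3] -/
theorem partitionMinorMonoid_isSuccinctHittingSet (F : Type*) [Field F] [CharZero F] :
    ∃ b n₀ : ℕ, ∀ n : ℕ, n₀ ≤ n → ∀ M : Set (Fin n →₀ ℕ),
      IsSuccinctHittingSet M (SmallDefinable F n b)
        (Submonoid.closure {P : MvPolynomial M F | ∃ (r : ℕ) (μ : Fin r → Fin r → M)
          (A B : Fin r → Finset (Fin n)), Function.Injective A ∧ Function.Injective B ∧
            (∀ i j, Disjoint (A i) (B j)) ∧
            (∀ i j, ((μ i j : M) : Fin n →₀ ℕ) =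
              ∑ a ∈ A i, Finsupp.single a 1 + ∑ c ∈ B j, Finsupp.single c 1) ∧
            P = (Matrix.of fun i j : Fin r => (X (μ i j) : MvPolynomial M F)).det} :
          Set (MvPolynomial M F)) ∧
      IsSuccinctHittingSetRel M (multilinearSlice F n) (SmallDefinable F n b)
        (Submonoid.closure {P : MvPolynomial M F | ∃ (r : ℕ) (μ : Fin r → Fin r → M)
          (A B : Fin r → Finset (Fin n)), Function.Injective A ∧ Function.Injective B ∧
            (∀ i j, Disjoint (A i) (B j)) ∧
            (∀ i j, ((μ i j : M) : Fin n →₀ ℕ) =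
              ∑ a ∈ A i, Finsupp.single a 1 + ∑ c ∈ B j, Finsupp.single c 1) ∧
            P = (Matrix.of fun i j : Fin r => (X (μ i j) : MvPolynomial M F)).det} :
          Set (MvPolynomial M F)) :=
  ⟨3, 6, fun n hn M =>
    ⟨fun _ hD _ => ⟨_, point_mem_smallDefinable hn, point_partitionMinorMonoid_ne_zero M hD⟩,
      fun _ hD _ => ⟨_, point_mem_smallDefinable hn, point_mem_multilinearSlice n,
        point_partitionMinorMonoid_ne_zero M hD⟩⟩⟩

end Summit.ValiantsHypothesis.ValiantsHypothesis.Theorems.SuccinctPartitionMinorsAllPartitions
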